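import Literature.NumberTheory.Rogawski1990.ArchInnerTwistChartDictionary   -- ★ p851905 (3): (H1′) `corresponds_gprimeTorus_archCongr_symm_gprimeTorus_iff`, `mem_splitChartPlaces_quasiSplitWeights`; brings ★ (EXH-G′) + §3 partner kit, ★ `partnerPerms`∕`slotPerm`
import HarnessLib

/-!
# The partner classes of a `G`-chart point in the inner form: `{γ′ ∈ G′_∞ | γ′ ↔ Φ⁻¹(gprimeTorus β₀ S′ c′)} ∕ conj = {[gprimeTorus α S′ (slotPerm ρ c′)] | ρ ∈ partnerPerms S′}`
# (N8-INNER brick (3′), the CLASS-SET reading of the chart dictionary; Rogawski 1990 §14.1, §3.1, §3.6; Shelstad 1979 §4 Lemma 4.2)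

Topic `NumberTheory/Rogawski1990`; namespace `Literature.NumberTheory.Rogawski1990`.  THEOREMS ONLY (no `def`, no instance, no notation, no axiom, no named fact,
no `sorry`).  Cell `pub/hodgecm-mathlib`, crux H413 (`stmt-HodgeConjecture-24833`), half-A line LH2, road «N8-INNER» (LEAD T14-4 (L2)); sequel (3′) of brick (3)
★ `ArchInnerTwistChartDictionary` (seat LH7-p04 (g8)), the `G′ ↔ G` twin of ★ ED. 2 §3 `forall_conjClasses_eq_mk_gprimeTorus_slotPerm` (`H ↔ G′`, LH7-p01 (g2)) — what the
READ-G brick (4) and the junction cert (11) index the `G′`-side stable sum by.  Count-neutral bookkeeping (lane `--supports`); pays no organ by itself.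

THE MATHEMATICS.  House frame of the inner form (`α_i ≠ 0`, `σ_w α_i` real); `β₀ = (½, 1, −½)` the quasi-split diagonal frame, `Φ : U(H₂)(L ⊗ ℝ) ≃ₜ* U(diag β₀)(L ⊗ ℝ)` a
congruence `g ↦ T g T⁻¹` (`H₂ = Φ₃`, `Φ = Ψ_Q` for (14.2.1)); `S′ ⊆` split-chart places of `α`, `c′ ∈ RegG S′`.  (P0) The `G`-chart point `x = Φ⁻¹(gprimeTorus β₀ S′ c′)` is regular
(★ `isRegularElt_gprimeTorus_iff_mem_regG` at `β₀`, ★ `isRegularElt_coe_archCongr_iff`).  (P1) EVERY partner-family point `gprimeTorus α S′ (slotPerm ρ c′)`, `ρ ∈ partnerPerms S′`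
(identity at the split places, any slot permutation at the compact ones), corresponds to `x`: at a split place the coordinates agree, at a compact place the unit eigenvalue triple is
permuted by `ρ_w` (★ (H1′)).  (P2) CONVERSELY every `γ′ ↔ x` is `G′_∞`-conjugate to a partner-family point: `γ′` is regular (★ `isRegularElt_iff_of_corresponds`), so (EXH-G′)
conjugates it to a regular chart point `gprimeTorus α S″ c″`, `S″ ⊆` split-chart places; the place-by-place eigenvalue matching (★ (H1′)) forces `S″ = S′` (norms `e^{±x} ≠ 1`),
`e^{iφ″} = e^{iφ′}`, `e^{iθ″} = e^{iθ′}`, `x″ = ±x′` on `S′` and `e^{ic″_i} = e^{ic′_{ρ i}}` off `S′`; the `−x′` places are flipped back inside the class (★ `isConj_gprimeTorus_flip`),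
after which the chart points are EQUAL (`2π`-periodicity, ★ `gprimeSplitGL_congr` ∕ `gprimeCptGL_congr`) — the proof of ★ ED. 2 §3 verbatim with `boostEig (c′ w)` for the `H`-triple.
Hence the partner classes of `x` are EXACTLY the classes of the partner family [Shelstad1979, Lemma 4.2: the Cartan subgroups of `G′` originating from `T ⊂ G` and their
`𝔄(T)`-labelling; Rogawski1990, §14.1 p. 232 «the conjugacy class of `ψ(γ′)` intersects `G` in a stable class», §3.6 p. 31].

* `isRegularElt_coe_archCongr_symm_gprimeTorus_iff` (P0), **`corresponds_gprimeTorus_slotPerm_archCongr_symm_gprimeTorus`** (P1),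
  **`forall_conjClasses_eq_mk_gprimeTorus_slotPerm_of_corresponds`** (P2), `exists_mem_partnerPerms_isConj_gprimeTorus_slotPerm_of_corresponds` (P2 for elements).
HONEST LABEL: HC_CM is proved only modulo the 7 printed citations (2 remaining: hLiu418 = `stmt-HodgeConjecture-24832`, h413 = `stmt-HodgeConjecture-24833`) until rung 0
closes; chart bookkeeping for the in-house road of row 2 `stub_N8`, count-neutral (+0∕+0).

## References
* [Rogawski1990] J. D. Rogawski, *Automorphic Representations of Unitary Groups in Three Variables*, Ann. of Math. Stud. 123 (1990), §3.1 p. 19, §3.6 p. 31, §4.3 p. 42–43,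
  §14.1 p. 232, §14.2 (14.2.1) pp. 232–233.
* [Shelstad1979] D. Shelstad, *Characters and inner forms of a quasi-split group over ℝ*, Compositio Math. 39 (1979), §4 pp. 22–25, Lemma 4.2 p. 23.
* [Knapp1986] A. W. Knapp, *Representation Theory of Semisimple Groups* (1986), Ch. V §3.
-/

set_option autoImplicit false

noncomputable section

open NumberField NumberField.InfinitePlace NumberField.mixedEmbedding Matrix Complex Polynomial
open scoped MatrixGroups Matrix ComplexConjugate Real Classical

namespace Literature.NumberTheory.Rogawski1990

open Literature.NumberTheory.Automorphic Literature.NumberTheory.Automorphic.UnitaryGroup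

section Partners

variable (L : Type) [Field L] [NumberField L] [IsCMField L] {H₂ : Matrix (Fin 3) (Fin 3) L} (T : GL (Fin 3) (mixedSpace L))
  (Φ : arch (↥(maximalRealSubfield L)) L (IsCMField.complexConj L) 3 H₂ ≃ₜ*
    arch (↥(maximalRealSubfield L)) L (IsCMField.complexConj L) 3 (Matrix.diagonal ![(2 : L)⁻¹, 1, -(2 : L)⁻¹]))
  (hΦ : ∀ g : arch (↥(maximalRealSubfield L)) L (IsCMField.complexConj L) 3 H₂,
    ((Φ g : arch (↥(maximalRealSubfield L)) L (IsCMField.complexConj L) 3 (Matrix.diagonal ![(2 : L)⁻¹, 1, -(2 : L)⁻¹])) : GL (Fin 3) (mixedSpace L)) =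
      T * (g : GL (Fin 3) (mixedSpace L)) * T⁻¹)
  {α : Fin 3 → L}

include hΦ in
/-- **(P0) THE `G`-CHART POINT IS REGULAR IFF ITS COORDINATES ARE**: `Φ⁻¹(gprimeTorus β₀ S′ c′)` is regular in `GL₃(L ⊗ ℝ)` iff `c′ ∈ RegG S′` (★ `isRegularElt_gprimeTorus_iff_mem_regG` at
`β₀`, every place being a split-chart place of `β₀`; regularity through `Φ` by ★ `isRegularElt_coe_archCongr_iff`). [cite: Rogawski1990, §3.1 p. 19; §3.6 p. 31] [cite: Shelstad1979, §4 p. 22] -/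
theorem isRegularElt_coe_archCongr_symm_gprimeTorus_iff (S' : Finset {w : InfinitePlace L // IsComplex w}) (c' : {w : InfinitePlace L // IsComplex w} → Fin 3 → ℝ) :
    IsRegularElt ((Φ.symm (gprimeTorus L ![(2 : L)⁻¹, 1, -(2 : L)⁻¹] S' c') : arch (↥(maximalRealSubfield L)) L (IsCMField.complexConj L) 3 H₂) : GL (Fin 3) (mixedSpace L)) ↔
      c' ∈ ArchCartan.RegG S' := by
  rw [← isRegularElt_coe_archCongr_iff L T Φ hΦ (Φ.symm _), ContinuousMulEquiv.apply_symm_apply]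
  exact isRegularElt_gprimeTorus_iff_mem_regG L _ S' c' fun w _ => mem_splitChartPlaces_quasiSplitWeights L w

include hΦ in
/-- **(P1) EVERY PARTNER-FAMILY POINT IS A PARTNER**: for `S′ ⊆` split-chart places of `α` and `ρ ∈ partnerPerms S′` (identity at the split places), the `α`-chart point with
coordinates `slotPerm ρ c′` corresponds to `Φ⁻¹(gprimeTorus β₀ S′ c′)` — at a split place the coordinates agree, at a compact place the unit eigenvalue triple is permuted by `ρ_w`
(★ (H1′) with `σ_w = ρ_w⁻¹`). [cite: Shelstad1979, Lemma 4.2 p. 23] [cite: Rogawski1990, §14.1 p. 232; §4.3 p. 43] -/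
theorem corresponds_gprimeTorus_slotPerm_archCongr_symm_gprimeTorus {S' : Finset {w : InfinitePlace L // IsComplex w}}
    (hS : ∀ w, w ∈ S' → w ∈ splitChartPlaces L α) (c' : {w : InfinitePlace L // IsComplex w} → Fin 3 → ℝ)
    (ρ : {w : InfinitePlace L // IsComplex w} → Equiv.Perm (Fin 3)) (hρ : ρ ∈ partnerPerms S') :
    Corresponds (conjMixed (↥(maximalRealSubfield L)) L (IsCMField.complexConj L)) (archFormOf L 3 (Matrix.diagonal α)) (archFormOf L 3 H₂)
      (gprimeTorus L α S' (slotPerm ρ c')) (Φ.symm (gprimeTorus L ![(2 : L)⁻¹, 1, -(2 : L)⁻¹] S' c')) := by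
  rw [corresponds_gprimeTorus_archCongr_symm_gprimeTorus_iff L T Φ hΦ hS]
  intro w
  by_cases hw : w ∈ S'
  · refine ⟨1, fun i => ?_⟩
    rw [if_pos hw, if_pos hw, slotPerm_apply_of_mem hρ hw, Equiv.Perm.coe_one, id]
  · refine ⟨(ρ w)⁻¹, fun i => ?_⟩
    rw [if_neg hw, if_neg hw]
    show Complex.exp ((c' w i : ℂ) * I) = Complex.exp ((slotPerm ρ c' w ((ρ w)⁻¹ i) : ℂ) * I)
    rw [slotPerm_apply, Equiv.Perm.inv_def, Equiv.apply_symm_apply]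

include hΦ in
/-- **(P2) EVERY PARTNER CLASS IS A PARTNER-FAMILY CLASS**: house frame of `α`, `S′ ⊆` split-chart places of `α`, `c′ ∈ RegG S′`.  Every conjugacy class `k` of `G′_∞ = U(diag α)(L⁺ ⊗ ℝ)`
corresponding to the `G`-chart point `Φ⁻¹(gprimeTorus β₀ S′ c′)` is the class of `gprimeTorus α S′ (slotPerm ρ c′)` for some `ρ ∈ partnerPerms S′`.  Route = ★ ED. 2 §3
`forall_conjClasses_eq_mk_gprimeTorus_slotPerm` with the `β₀`-chart point for the `H`-chart point: regularity transport, (EXH-G′), place-by-place matching (★ (H1′)) forcing `S″ = S′`,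
`x″ = ±x′`, equal unit phases, the `−x′` places flipped back inside the class (★ `isConj_gprimeTorus_flip`). [cite: Shelstad1979, Lemma 4.2 p. 23; §4 pp. 22–25]
[cite: Rogawski1990, §14.1 p. 232; §3.6 p. 31; §3.1 p. 19] [cite: Knapp1986, Ch. V §3] -/
theorem forall_conjClasses_eq_mk_gprimeTorus_slotPerm_of_corresponds (hα : ∀ i, α i ≠ 0)
    (hreal : ∀ (w : {w : InfinitePlace L // IsComplex w}) (i : Fin 3), (w.1.embedding (α i)).im = 0)
    {S' : Finset {w : InfinitePlace L // IsComplex w}} (hS : ∀ w, w ∈ S' → w ∈ splitChartPlaces L α)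
    {c' : {w : InfinitePlace L // IsComplex w} → Fin 3 → ℝ} (hc' : c' ∈ ArchCartan.RegG S') :
    ∀ k : ConjClasses ↥(arch (↥(maximalRealSubfield L)) L (IsCMField.complexConj L) 3 (Matrix.diagonal α)),
      Corresponds (conjMixed (↥(maximalRealSubfield L)) L (IsCMField.complexConj L)) (archFormOf L 3 (Matrix.diagonal α)) (archFormOf L 3 H₂)
          (Quotient.out k) (Φ.symm (gprimeTorus L ![(2 : L)⁻¹, 1, -(2 : L)⁻¹] S' c')) →
        ∃ ρ ∈ partnerPerms S', k = ConjClasses.mk (gprimeTorus L α S' (slotPerm ρ c')) := by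
  intro k hcorr
  set γ' : ↥(arch (↥(maximalRealSubfield L)) L (IsCMField.complexConj L) 3 (Matrix.diagonal α)) := Quotient.out k with hγ'
  have hout : ConjClasses.mk γ' = k := by rw [hγ', ← ConjClasses.quotient_mk_eq_mk]; exact Quotient.out_eq k
  -- `γ′` is regular
  have hregx := (isRegularElt_coe_archCongr_symm_gprimeTorus_iff L T Φ hΦ S' c').2 hc'
  have hreg : IsRegularElt (γ' : GL (Fin 3) (mixedSpace L)) := (isRegularElt_iff_of_corresponds hcorr).2 hregx
  -- (EXH-G′)
  obtain ⟨S'', c'', g, hS'', hc'', hconj⟩ := exists_conj_gprimeTorus_of_isRegularElt L α hα hreal γ' hreg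
  have hcorr' : Corresponds (conjMixed (↥(maximalRealSubfield L)) L (IsCMField.complexConj L)) (archFormOf L 3 (Matrix.diagonal α)) (archFormOf L 3 H₂)
      (gprimeTorus L α S'' c'') (Φ.symm (gprimeTorus L ![(2 : L)⁻¹, 1, -(2 : L)⁻¹] S' c')) :=
    hcorr.of_isStablyConj_left (isStablyConj_arch_of_isConj L 3 (Matrix.diagonal α) (isConj_iff.2 ⟨g, hconj.symm⟩).symm)
  have hplace' := (corresponds_gprimeTorus_archCongr_symm_gprimeTorus_iff L T Φ hΦ hS'' c'' S' c').1 hcorr'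
  have hplace : ∀ w : {w : InfinitePlace L // IsComplex w}, ∃ σ : Equiv.Perm (Fin 3), ∀ i : Fin 3,
      (if w ∈ S'' then boostEig (c'' w) else fun i => Complex.exp ((c'' w i : ℂ) * I)) i =
        (if w ∈ S' then boostEig (c' w) else fun i => Complex.exp ((c' w i : ℂ) * I)) (σ i) := by
    intro w
    obtain ⟨σ, hσ⟩ := hplace' w
    refine ⟨σ.symm, fun i => ?_⟩
    have h := hσ (σ.symm i)
    rw [Equiv.apply_symm_apply] at h
    exact h.symm
  have hx : ∀ w, w ∈ S' → c' w 0 ≠ 0 := ((ArchCartan.mem_regG_iff S' c').1 hc').2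
  have hx'' : ∀ w, w ∈ S'' → c'' w 0 ≠ 0 := ((ArchCartan.mem_regG_iff S'' c'').1 hc'').2
  have hB : ∀ (cw : Fin 3 → ℝ) (j : Fin 3), boostEig cw j = if j = 0 then Complex.exp ((cw 0 : ℂ) + (cw 2 : ℂ) * I) else if j = 1 then Complex.exp ((cw 1 : ℂ) * I)
      else Complex.exp (-(cw 0 : ℂ) + (cw 2 : ℂ) * I) := by
    intro cw j; fin_cases j <;> rfl
  -- the chart sets agree
  have hSS : S'' = S' := by
    ext w
    obtain ⟨σ, hσ⟩ := hplace w
    constructor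
    · intro hw'
      by_contra hw
      have h : Complex.exp ((c'' w 0 : ℂ) + (c'' w 2 : ℂ) * I) = Complex.exp ((c' w (σ 0) : ℂ) * I) := by
        have h0 := hσ 0; rw [if_pos hw', if_neg hw, hB] at h0; exact h0
      have hn := congrArg (fun z : ℂ => ‖z‖) h
      simp only [norm_exp_ofReal_add_ofReal_mul_I, Complex.norm_exp_ofReal_mul_I] at hn
      exact hx'' w hw' ((Real.exp_eq_one_iff _).1 hn)
    · intro hw
      by_contra hw'
      have h : Complex.exp ((c'' w (σ.symm 0) : ℂ) * I) = Complex.exp ((c' w 0 : ℂ) + (c' w 2 : ℂ) * I) := by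
        have h0 := hσ (σ.symm 0); rw [if_neg hw', if_pos hw, Equiv.apply_symm_apply, hB] at h0; exact h0
      have hn := congrArg (fun z : ℂ => ‖z‖) h
      simp only [norm_exp_ofReal_add_ofReal_mul_I, Complex.norm_exp_ofReal_mul_I] at hn
      exact hx w hw ((Real.exp_eq_one_iff _).1 hn.symm)
  subst hSS
  -- per-place reading of the matching at the split places
  have hsplit : ∀ w, w ∈ S'' → (c'' w 0 = c' w 0 ∨ c'' w 0 = -(c' w 0)) ∧
      Complex.exp ((c'' w 1 : ℂ) * I) = Complex.exp ((c' w 1 : ℂ) * I) ∧ Complex.exp ((c'' w 2 : ℂ) * I) = Complex.exp ((c' w 2 : ℂ) * I) := by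
    intro w hw
    obtain ⟨σ, hσ⟩ := hplace w
    have hG : ∀ i : Fin 3, boostEig (c'' w) i = boostEig (c' w) (σ i) := by
      intro i; have h0 := hσ i; rw [if_pos hw, if_pos hw] at h0; exact h0
    have h1 : σ 1 = 1 := by
      by_contra hne
      have h : Complex.exp ((c'' w 1 : ℂ) * I) = boostEig (c' w) (σ 1) := by rw [← hG 1, hB, if_neg (by decide), if_pos rfl]
      rw [hB] at h
      rcases fin_three_eq_zero_or_two (σ 1) hne with h0 | h2
      · rw [h0, if_pos rfl] at h
        have hn := congrArg (fun z : ℂ => ‖z‖) h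
        simp only [norm_exp_ofReal_add_ofReal_mul_I, Complex.norm_exp_ofReal_mul_I] at hn
        exact hx w hw ((Real.exp_eq_one_iff _).1 hn.symm)
      · rw [h2, if_neg (by decide), if_neg (by decide)] at h
        have hn := congrArg (fun z : ℂ => ‖z‖) h
        simp only [norm_exp_neg_ofReal_add_ofReal_mul_I, Complex.norm_exp_ofReal_mul_I] at hn
        exact hx w hw (neg_eq_zero.1 ((Real.exp_eq_one_iff _).1 hn.symm))
    have hφ : Complex.exp ((c'' w 1 : ℂ) * I) = Complex.exp ((c' w 1 : ℂ) * I) := by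
      have h : boostEig (c'' w) 1 = boostEig (c' w) (σ 1) := hG 1
      rw [h1, hB, hB, if_neg (by decide), if_pos rfl, if_neg (by decide), if_pos rfl] at h
      exact h
    have h0ne : σ 0 ≠ 1 := fun h => absurd (σ.injective (h.trans h1.symm)) (by decide)
    have hG0 : Complex.exp ((c'' w 0 : ℂ) + (c'' w 2 : ℂ) * I) = boostEig (c' w) (σ 0) := by rw [← hG 0, hB, if_pos rfl]
    rw [hB] at hG0
    rcases fin_three_eq_zero_or_two (σ 0) h0ne with h00 | h02
    · rw [h00, if_pos rfl] at hG0
      obtain ⟨hxx, hθ⟩ := eq_and_exp_eq_of_exp_add_eq hG0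
      exact ⟨Or.inl hxx, hφ, hθ⟩
    · rw [h02, if_neg (by decide), if_neg (by decide), ← Complex.ofReal_neg] at hG0
      obtain ⟨hxx, hθ⟩ := eq_and_exp_eq_of_exp_add_eq hG0
      exact ⟨Or.inr hxx, hφ, hθ⟩
  have hcpt : ∀ w, w ∉ S'' → ∃ σ : Equiv.Perm (Fin 3), ∀ i, Complex.exp ((c'' w i : ℂ) * I) = Complex.exp ((c' w (σ i) : ℂ) * I) := by
    intro w hw
    obtain ⟨σ, hσ⟩ := hplace w
    refine ⟨σ, fun i => ?_⟩
    have h := hσ i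
    rw [if_neg hw, if_neg hw] at h
    exact h
  choose σc hσc using hcpt
  -- the partner permutation
  set ρ : {w : InfinitePlace L // IsComplex w} → Equiv.Perm (Fin 3) := fun w => if hw : w ∈ S'' then 1 else σc w hw with hρ
  have hρmem : ρ ∈ partnerPerms S'' := (mem_partnerPerms_iff S'' ρ).2 fun w hw => by simp only [hρ, dif_pos hw]
  refine ⟨ρ, hρmem, ?_⟩
  -- flip back the `−x′` places
  set T' : Finset {w : InfinitePlace L // IsComplex w} := S''.filter fun w => c'' w 0 = -(c' w 0) with hT'
  have hTS : T' ⊆ S'' := Finset.filter_subset _ _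
  have hflip := isConj_gprimeTorus_flip L α S'' c'' hS'' T' hTS
  -- after the flip the chart point IS the partner point
  have heq : gprimeTorus L α S'' (fun w => if w ∈ T' then ![-(c'' w 0), c'' w 1, c'' w 2] else c'' w) = gprimeTorus L α S'' (slotPerm ρ c') := by
    apply (archPiEquivCM 3 L (Matrix.diagonal α)).injective
    funext w
    rw [archPiEquivCM_gprimeTorus, archPiEquivCM_gprimeTorus]
    apply Subtype.ext
    by_cases hw : w ∈ S''
    · obtain ⟨h0, h1, h2⟩ := hsplit w hw
      have hρw : slotPerm ρ c' w = c' w := slotPerm_apply_of_eq_one (by simp only [hρ, dif_pos hw]) c'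
      rw [coe_gprimeBlock_of_mem L α _ hw (hS'' w hw), coe_gprimeBlock_of_mem L α _ hw (hS'' w hw), hρw]
      by_cases hwT : w ∈ T'
      · have hneg : c'' w 0 = -(c' w 0) := (Finset.mem_filter.1 hwT).2
        rw [if_pos hwT]
        refine gprimeSplitGL_congr _ _ ?_ ?_ ?_
        · simp [hneg]
        · simpa using h1
        · simpa using h2
      · have hpos : c'' w 0 = c' w 0 := by
          rcases h0 with h | h
          · exact h
          · exact absurd (Finset.mem_filter.2 ⟨hw, h⟩) hwT
        rw [if_neg hwT]
        exact gprimeSplitGL_congr _ _ hpos h1 h2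
    · have hwT : w ∉ T' := fun h => hw (hTS h)
      rw [coe_gprimeBlock_of_not_mem L α _ hw, coe_gprimeBlock_of_not_mem L α _ hw, if_neg hwT]
      refine gprimeCptGL_congr _ fun i => ?_
      rw [hσc w hw i, slotPerm_apply, hρ]
      simp only [dif_neg hw]
  -- assemble the classes
  rw [← hout, hconj, ConjClasses.mk_eq_mk_iff_isConj]
  refine ((isConj_iff.2 ⟨g, rfl⟩).symm).trans ?_
  rw [← heq]
  exact hflip

include hΦ in
/-- **(P2) for elements**: every `γ′ ∈ G′_∞` corresponding to `Φ⁻¹(gprimeTorus β₀ S′ c′)` (frame, `S′`, `c′` as in (P2)) is `G′_∞`-CONJUGATE to a partner-family point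
`gprimeTorus α S′ (slotPerm ρ c′)`, `ρ ∈ partnerPerms S′` — so on branch (i) of (14.2.1) the `G′`-side stable orbital integral at ANY partner is the one at the chart's own partner family.
[cite: Shelstad1979, Lemma 4.2 p. 23] [cite: Rogawski1990, §14.1 p. 232; §14.2 (14.2.1) p. 232] -/
theorem exists_mem_partnerPerms_isConj_gprimeTorus_slotPerm_of_corresponds (hα : ∀ i, α i ≠ 0)
    (hreal : ∀ (w : {w : InfinitePlace L // IsComplex w}) (i : Fin 3), (w.1.embedding (α i)).im = 0)
    {S' : Finset {w : InfinitePlace L // IsComplex w}} (hS : ∀ w, w ∈ S' → w ∈ splitChartPlaces L α)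
    {c' : {w : InfinitePlace L // IsComplex w} → Fin 3 → ℝ} (hc' : c' ∈ ArchCartan.RegG S')
    (γ' : ↥(arch (↥(maximalRealSubfield L)) L (IsCMField.complexConj L) 3 (Matrix.diagonal α)))
    (h : Corresponds (conjMixed (↥(maximalRealSubfield L)) L (IsCMField.complexConj L)) (archFormOf L 3 (Matrix.diagonal α)) (archFormOf L 3 H₂)
      γ' (Φ.symm (gprimeTorus L ![(2 : L)⁻¹, 1, -(2 : L)⁻¹] S' c'))) :
    ∃ ρ ∈ partnerPerms S', IsConj γ' (gprimeTorus L α S' (slotPerm ρ c')) := by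
  have hout' : (⟦Quotient.out (ConjClasses.mk γ')⟧ : ConjClasses ↥(arch (↥(maximalRealSubfield L)) L (IsCMField.complexConj L) 3 (Matrix.diagonal α))) =
      ConjClasses.mk γ' := Quotient.out_eq _
  rw [ConjClasses.quotient_mk_eq_mk] at hout'
  have hout : IsConj γ' (Quotient.out (ConjClasses.mk γ')) := ConjClasses.mk_eq_mk_iff_isConj.1 hout'.symm
  have h' : Corresponds (conjMixed (↥(maximalRealSubfield L)) L (IsCMField.complexConj L)) (archFormOf L 3 (Matrix.diagonal α)) (archFormOf L 3 H₂)
      (Quotient.out (ConjClasses.mk γ')) (Φ.symm (gprimeTorus L ![(2 : L)⁻¹, 1, -(2 : L)⁻¹] S' c')) :=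
    h.of_isStablyConj_left (isStablyConj_arch_of_isConj L 3 (Matrix.diagonal α) hout)
  obtain ⟨ρ, hρ, hk⟩ := forall_conjClasses_eq_mk_gprimeTorus_slotPerm_of_corresponds L T Φ hΦ hα hreal hS hc' (ConjClasses.mk γ') h'
  exact ⟨ρ, hρ, ConjClasses.mk_eq_mk_iff_isConj.1 hk⟩

end Partners

end Literature.NumberTheory.Rogawski1990

end
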